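import Summits.QuantumFields.YangMills.Theorems.AllWindowsColdBoxBoxHighLineSimplexFlowEnergy

/-!
# LINE-19, toward S3a `LandauVarianceBounded` (crux `AllWindowsColdBox.BoxHighWindowsSU22`, stmt-QuantumFields-24004 / low item 24335),
# part 3: the lattice Sobolev inequality on a slice

* `lattice_sobolev` — **if `g : ℤ⁴ → ℝ` is supported on sites of `[0,N]⁴` whose three coordinates other than `i` lie in `[1,N−1]`,
  then `g(x)² ≤ 4 · Σ_{τ ≠ i} Σ_y (g(y+e_τ) − g(y))²`** (sums over the cube `[-2,N+2]⁴`), uniformly in `N` and `x`: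
  `g(x) = Σ_y g(y)·div θ(y) = −Σ_{τ≠i} Σ_y θ(y,τ)·(g(y+e_τ) − g(y))` (summation by parts, the divergence of the simplex flow being `δ_x`
  wherever `g` can be non-zero), then Cauchy–Schwarz and the energy bound `≤ 4` of part 2 — the transience of `ℤ³`.
HONEST LABEL: helper toward the first conjunct (S3a `LandauVarianceBounded`) of registered stub S3 of a critic-PASSed line on
the R2ξ″ crux ⟨24004⟩; no crux, rung or summit is proved; the Yang–Mills mass gap is NOT proved by this file.
-/

set_option autoImplicit false

open Finset

namespace Summit.QuantumFields.YangMills.Theorems.AllWindowsColdBoxBoxHighLine.HodgePoincare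

/-- **Lattice Sobolev inequality on a slice.**  If `g : ℤ⁴ → ℝ` is supported on sites of the cube `[0,N]⁴` whose three
coordinates other than `i` lie in `[1, N−1]`, then at every site `x`,
`g(x)² ≤ 4 · Σ_{τ ≠ i} Σ_y (g(y + e_τ) − g(y))²` (sums over the cube `[-2, N+2]⁴`): the transience of `ℤ³`, via the
Pólya simplex flow from `x` inside the slice `{y_i = x_i}`. -/
theorem lattice_sobolev (N : ℕ) (i : Fin 4) (g : (Fin 4 → ℤ) → ℝ)
    (hg : ∀ y, g y ≠ 0 → (∀ k, 0 ≤ y k ∧ y k ≤ N) ∧ (∀ τ, τ ≠ i → 1 ≤ y τ ∧ y τ + 1 ≤ N)) (x : Fin 4 → ℤ) :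
    g x ^ 2 ≤ 4 * ∑ τ : Fin 4, (if τ ≠ i then
      ∑ y ∈ Fintype.piFinset (fun _ : Fin 4 => Finset.Icc (-2 : ℤ) (N + 2)), (g (y + Pi.single τ 1) - g y) ^ 2 else 0) := by
  have hRHS : 0 ≤ ∑ τ : Fin 4, (if τ ≠ i then
      ∑ y ∈ Fintype.piFinset (fun _ : Fin 4 => Finset.Icc (-2 : ℤ) (N + 2)), (g (y + Pi.single τ 1) - g y) ^ 2 else 0) := by
    refine Finset.sum_nonneg fun τ _ => ?_
    by_cases h : τ ≠ i
    · rw [if_pos h]; exact Finset.sum_nonneg fun y _ => sq_nonneg _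
    · rw [if_neg h]
  by_cases hgx : g x = 0
  · rw [hgx]; nlinarith
  obtain ⟨hxbox, hxcore⟩ := hg x hgx
  have hx0 : ∀ k, 0 ≤ x k := fun k => (hxbox k).1
  have hxB : x ∈ Fintype.piFinset (fun _ : Fin 4 => Finset.Icc (-2 : ℤ) ((N : ℤ) + 2)) := by
    rw [mem_box]; intro k; have := hxbox k; constructor <;> omega
  -- the flow
  obtain ⟨m, hm⟩ : ∃ m : (Fin 4 → ℤ) → ℤ, ∀ y, m y = ∑ k : Fin 4, (if k ≠ i then y k - x k else 0) :=
    ⟨_, fun _ => rfl⟩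
  obtain ⟨θ, hθ⟩ : ∃ θ : (Fin 4 → ℤ) → Fin 4 → ℝ, ∀ y τ, θ y τ =
      if (τ ≠ i ∧ y i = x i ∧ ∀ k, k ≠ i → x k ≤ y k ∧ y k + 1 ≤ N) then
        2 / (((m y : ℝ) + 1) * ((m y : ℝ) + 2)) * (((y τ - x τ : ℤ) : ℝ) + 1) / ((m y : ℝ) + 3) else 0 :=
    ⟨_, fun _ _ => rfl⟩
  -- Step 1: g x = Σ_y g y · div θ (y)
  have hdiv : ∀ y, g y * ∑ τ : Fin 4, (if τ ≠ i then θ y τ - θ (y - Pi.single τ 1) τ else 0) =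
      if y = x then g x else 0 := by
    intro y
    by_cases hR : y i = x i ∧ ∀ k, k ≠ i → x k ≤ y k ∧ y k + 1 ≤ N
    · rw [divergence m hm θ hθ hR.1 hR.2]
      by_cases hyx : y = x
      · subst hyx; simp
      · rw [if_neg hyx, if_neg hyx, mul_zero]
    · by_cases hweak : y i = x i ∧ ∀ k, k ≠ i → x k ≤ y k
      · have hgy : g y = 0 := by
          by_contra hne
          exact hR ⟨hweak.1, fun k hk => ⟨hweak.2 k hk, ((hg y hne).2 k hk).2⟩⟩
        have hyx : y ≠ x := by
          rintro rfl; exact hR ⟨rfl, fun k hk => ⟨le_rfl, (hxcore k hk).2⟩⟩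
        rw [hgy, zero_mul, if_neg hyx]
      · rw [divergence_zero_of_not_region m θ hθ hweak, mul_zero]
        have hyx : y ≠ x := by
          rintro rfl; exact hweak ⟨rfl, fun k _ => le_rfl⟩
        rw [if_neg hyx]
  have hrep : g x = ∑ y ∈ Fintype.piFinset (fun _ : Fin 4 => Finset.Icc (-2 : ℤ) ((N : ℤ) + 2)),
      g y * ∑ τ : Fin 4, (if τ ≠ i then θ y τ - θ (y - Pi.single τ 1) τ else 0) := by
    rw [Finset.sum_congr rfl fun y _ => hdiv y, Finset.sum_ite_eq' _ x, if_pos hxB]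
  -- Step 2: summation by parts, direction by direction
  have hθsupp : ∀ y τ, θ y τ ≠ 0 → (∀ k, 0 ≤ y k ∧ y k ≤ N) := by
    intro y τ h k
    rw [hθ] at h
    split_ifs at h with hc
    · obtain ⟨-, hyi, hreg⟩ := hc
      by_cases hk : k = i
      · subst hk; rw [hyi]; exact hxbox k
      · have := hreg k hk; have := hxbox k; constructor <;> omega
    · exact absurd rfl h
  have hshift : ∀ τ : Fin 4, ∑ y ∈ Fintype.piFinset (fun _ : Fin 4 => Finset.Icc (-2 : ℤ) ((N : ℤ) + 2)),
      g y * θ (y - Pi.single τ 1) τ =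
      ∑ y ∈ Fintype.piFinset (fun _ : Fin 4 => Finset.Icc (-2 : ℤ) ((N : ℤ) + 2)), g (y + Pi.single τ 1) * θ y τ := by
    intro τ
    have key := sum_shift_eq (a := -2) (b := (N : ℤ) + 2) (-Pi.single τ 1)
      (fun w => g (w + Pi.single τ 1) * θ w τ) ?_
    · refine Eq.trans (Finset.sum_congr rfl fun y _ => ?_) key
      have h1 : y + -Pi.single τ 1 + Pi.single τ 1 = y := by abel
      have h2 : y + -Pi.single τ 1 = y - Pi.single τ 1 := by abel
      rw [h1, h2]
    · intro w hw
      obtain ⟨-, hb⟩ := mul_ne_zero_iff.1 hw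
      have hwb := hθsupp w τ hb
      have he := single_one_apply_bounds τ
      refine ⟨fun k => by have := hwb k; constructor <;> omega, fun k => ?_⟩
      have := hwb k; have := he k
      rw [Pi.neg_apply]
      constructor <;> omega
  have hparts : ∀ τ : Fin 4,
      ∑ y ∈ Fintype.piFinset (fun _ : Fin 4 => Finset.Icc (-2 : ℤ) ((N : ℤ) + 2)),
        g y * (θ y τ - θ (y - Pi.single τ 1) τ) =
      - ∑ y ∈ Fintype.piFinset (fun _ : Fin 4 => Finset.Icc (-2 : ℤ) ((N : ℤ) + 2)),
        θ y τ * (g (y + Pi.single τ 1) - g y) := by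
    intro τ
    have A : ∑ y ∈ Fintype.piFinset (fun _ : Fin 4 => Finset.Icc (-2 : ℤ) ((N : ℤ) + 2)),
        g y * (θ y τ - θ (y - Pi.single τ 1) τ) =
        ∑ y ∈ Fintype.piFinset (fun _ : Fin 4 => Finset.Icc (-2 : ℤ) ((N : ℤ) + 2)), g y * θ y τ -
        ∑ y ∈ Fintype.piFinset (fun _ : Fin 4 => Finset.Icc (-2 : ℤ) ((N : ℤ) + 2)), g y * θ (y - Pi.single τ 1) τ := by
      rw [← Finset.sum_sub_distrib]; exact Finset.sum_congr rfl fun y _ => by ring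
    have B : ∑ y ∈ Fintype.piFinset (fun _ : Fin 4 => Finset.Icc (-2 : ℤ) ((N : ℤ) + 2)),
        θ y τ * (g (y + Pi.single τ 1) - g y) =
        ∑ y ∈ Fintype.piFinset (fun _ : Fin 4 => Finset.Icc (-2 : ℤ) ((N : ℤ) + 2)), g (y + Pi.single τ 1) * θ y τ -
        ∑ y ∈ Fintype.piFinset (fun _ : Fin 4 => Finset.Icc (-2 : ℤ) ((N : ℤ) + 2)), g y * θ y τ := by
      rw [← Finset.sum_sub_distrib]; exact Finset.sum_congr rfl fun y _ => by ring
    rw [A, B, hshift τ]; ring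
  -- g x = − Σ_{τ ≠ i} Σ_y θ · ∇g
  have hrep2 : g x = - ∑ τ : Fin 4, (if τ ≠ i then
      ∑ y ∈ Fintype.piFinset (fun _ : Fin 4 => Finset.Icc (-2 : ℤ) ((N : ℤ) + 2)),
        θ y τ * (g (y + Pi.single τ 1) - g y) else 0) := by
    have step1 : ∑ y ∈ Fintype.piFinset (fun _ : Fin 4 => Finset.Icc (-2 : ℤ) ((N : ℤ) + 2)),
        g y * ∑ τ : Fin 4, (if τ ≠ i then θ y τ - θ (y - Pi.single τ 1) τ else 0) =
        ∑ τ : Fin 4, ∑ y ∈ Fintype.piFinset (fun _ : Fin 4 => Finset.Icc (-2 : ℤ) ((N : ℤ) + 2)),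
          (if τ ≠ i then g y * (θ y τ - θ (y - Pi.single τ 1) τ) else 0) := by
      rw [Finset.sum_comm]
      refine Finset.sum_congr rfl fun y _ => ?_
      rw [Finset.mul_sum]
      refine Finset.sum_congr rfl fun τ _ => ?_
      by_cases h : τ ≠ i
      · rw [if_pos h, if_pos h]
      · rw [if_neg h, if_neg h, mul_zero]
    have step2 : ∀ τ : Fin 4, ∑ y ∈ Fintype.piFinset (fun _ : Fin 4 => Finset.Icc (-2 : ℤ) ((N : ℤ) + 2)),
        (if τ ≠ i then g y * (θ y τ - θ (y - Pi.single τ 1) τ) else 0) =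
        if τ ≠ i then - ∑ y ∈ Fintype.piFinset (fun _ : Fin 4 => Finset.Icc (-2 : ℤ) ((N : ℤ) + 2)),
          θ y τ * (g (y + Pi.single τ 1) - g y) else 0 := by
      intro τ
      by_cases h : τ ≠ i
      · rw [if_pos h, ← hparts τ]
        exact Finset.sum_congr rfl fun y _ => by rw [if_pos h]
      · rw [if_neg h]
        exact Finset.sum_eq_zero fun y _ => by rw [if_neg h]
    rw [hrep, step1, Finset.sum_congr rfl fun τ _ => step2 τ, ← Finset.sum_neg_distrib]
    refine Finset.sum_congr rfl fun τ _ => ?_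
    by_cases h : τ ≠ i
    · rw [if_pos h, if_pos h]
    · rw [if_neg h, if_neg h, neg_zero]
  -- Step 3: Cauchy–Schwarz on the index set `Fin 4 × box`
  have hcs : (∑ τ : Fin 4, (if τ ≠ i then
      ∑ y ∈ Fintype.piFinset (fun _ : Fin 4 => Finset.Icc (-2 : ℤ) ((N : ℤ) + 2)),
        θ y τ * (g (y + Pi.single τ 1) - g y) else 0)) ^ 2 ≤
      (∑ τ : Fin 4, (if τ ≠ i then
        ∑ y ∈ Fintype.piFinset (fun _ : Fin 4 => Finset.Icc (-2 : ℤ) ((N : ℤ) + 2)), θ y τ ^ 2 else 0)) *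
      (∑ τ : Fin 4, (if τ ≠ i then
        ∑ y ∈ Fintype.piFinset (fun _ : Fin 4 => Finset.Icc (-2 : ℤ) ((N : ℤ) + 2)), (g (y + Pi.single τ 1) - g y) ^ 2 else 0)) := by
    have e1 : ∑ τ : Fin 4, (if τ ≠ i then
        ∑ y ∈ Fintype.piFinset (fun _ : Fin 4 => Finset.Icc (-2 : ℤ) ((N : ℤ) + 2)),
          θ y τ * (g (y + Pi.single τ 1) - g y) else 0) =
        ∑ p ∈ (Finset.univ : Finset (Fin 4)) ×ˢ Fintype.piFinset (fun _ : Fin 4 => Finset.Icc (-2 : ℤ) ((N : ℤ) + 2)),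
          (if p.1 ≠ i then θ p.2 p.1 else 0) * (if p.1 ≠ i then (g (p.2 + Pi.single p.1 1) - g p.2) else 0) := by
      rw [Finset.sum_product]
      refine Finset.sum_congr rfl fun τ _ => ?_
      by_cases h : τ ≠ i
      · simp only [if_pos h]
      · simp only [if_neg h, zero_mul, Finset.sum_const_zero]
    have e2 : ∑ τ : Fin 4, (if τ ≠ i then
        ∑ y ∈ Fintype.piFinset (fun _ : Fin 4 => Finset.Icc (-2 : ℤ) ((N : ℤ) + 2)), θ y τ ^ 2 else 0) =
        ∑ p ∈ (Finset.univ : Finset (Fin 4)) ×ˢ Fintype.piFinset (fun _ : Fin 4 => Finset.Icc (-2 : ℤ) ((N : ℤ) + 2)),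
          (if p.1 ≠ i then θ p.2 p.1 else 0) ^ 2 := by
      rw [Finset.sum_product]
      refine Finset.sum_congr rfl fun τ _ => ?_
      by_cases h : τ ≠ i
      · simp only [if_pos h]
      · simp only [if_neg h, ne_eq, OfNat.ofNat_ne_zero, not_false_eq_true, zero_pow, Finset.sum_const_zero]
    have e3 : ∑ τ : Fin 4, (if τ ≠ i then
        ∑ y ∈ Fintype.piFinset (fun _ : Fin 4 => Finset.Icc (-2 : ℤ) ((N : ℤ) + 2)), (g (y + Pi.single τ 1) - g y) ^ 2 else 0) =
        ∑ p ∈ (Finset.univ : Finset (Fin 4)) ×ˢ Fintype.piFinset (fun _ : Fin 4 => Finset.Icc (-2 : ℤ) ((N : ℤ) + 2)),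
          (if p.1 ≠ i then (g (p.2 + Pi.single p.1 1) - g p.2) else 0) ^ 2 := by
      rw [Finset.sum_product]
      refine Finset.sum_congr rfl fun τ _ => ?_
      by_cases h : τ ≠ i
      · simp only [if_pos h]
      · simp only [if_neg h, ne_eq, OfNat.ofNat_ne_zero, not_false_eq_true, zero_pow, Finset.sum_const_zero]
    rw [e1, e2, e3]
    have := Finset.sum_mul_sq_le_sq_mul_sq
      ((Finset.univ : Finset (Fin 4)) ×ˢ Fintype.piFinset (fun _ : Fin 4 => Finset.Icc (-2 : ℤ) ((N : ℤ) + 2)))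
      (fun p => if p.1 ≠ i then θ p.2 p.1 else 0) (fun p => if p.1 ≠ i then (g (p.2 + Pi.single p.1 1) - g p.2) else 0)
    simpa only [sq] using this
  have henergy := flow_energy_le N i x hx0 m hm θ hθ
  rw [hrep2, neg_sq]
  exact hcs.trans (mul_le_mul_of_nonneg_right henergy hRHS)

end Summit.QuantumFields.YangMills.Theorems.AllWindowsColdBoxBoxHighLine.HodgePoincare
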